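import Literature.NumberTheory.EllipticCurves.IwasawaEisensteinTwistedRepH1Transport
import Literature.NumberTheory.EllipticCurves.IwasawaEisensteinTwistedCocycleInjectiveProofs
import HarnessLib

/-!
# `H¹(K, M ⊗ A_{m,k}(χ)) ≅ H¹(K_∞, M)[(conj_γ − 1)^m + p]`: class-level properties of the level readout

Topic `NumberTheory/EllipticCurves` (sequel to `IwasawaEisensteinTwistedRepH1Transport` (the level readout
`eisensteinTwistLevelReadout : galoisCohomology (κ.eisensteinTwist ρ hm k) 1 →+ subgroupH1 κ₀.kerSubgroup M` and its surjectivity onto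
the `ψ_m`-kernel), `IwasawaEisensteinTwistedCocycleReadoutProofs` (shift relations of the coordinate classes) and
`IwasawaEisensteinTwistedCocycleInjectiveProofs` (all coordinates zero ⇒ twisted coboundary); cell `pub/bsd-print-x9`, blueprint
HOME/p2/S1-DISCRETE-CONTROL §1(a)–(c), step F4b).  Theorems only; no definition, no named fact, no `sorry`.

* `exists_coordCocycles`: the coordinate cocycles `φ_j(h) = λ_k([π_j^*] ξ(h))` of a D1 cocycle `ξ` restricted to `Gal(K̄/K_∞)`;
* `eisensteinTwistLevelReadout_oneCocycleClass`: the level readout of `[ξ]` is `[φ_{m-1}]`;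
* **`psi_apply_eisensteinTwistLevelReadout_eq_zero`**: the image of the level readout is killed by `ψ_m = (conj_γ − 1)^m + p`;
* **`eq_zero_of_eisensteinTwistLevelReadout_eq_zero`**: the level readout is injective when `M^{Gal(K̄/K_∞)} = 0`.
Together with `exists_eisensteinTwistLevelReadout_eq` (transport file): the level-`k` map `ι_{m,k}` of Howard's comparison
`H¹(K, A_𝔮) → H¹(K_∞, E[p^∞])[𝔮]`, `𝔮 = ((γ−1)^m + p)`, is an isomorphism onto the `ψ_m`-kernel at the level of full `H¹`.

References: [Howard2004HeegnerKolyvagin] §2.2, Lemma 1.3.3, proof of Thm. 2.2.10; [GreenbergLNM1716] §4 pp. 107, 124; [Washington1997] §13.2.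
BSD is not proved by any of this.
-/

noncomputable section

open Literature.NumberTheory.EllipticCurves Literature.NumberTheory.GaloisRepresentations Field
open CategoryTheory ContinuousCohomology IwasawaAlgebra IwasawaAlgebra.EisensteinCoeff IwasawaAlgebra.EisensteinCoeff.TwistedBy

universe u

namespace Literature.NumberTheory.EllipticCurves

namespace ZpExtension

variable {K : Type u} [Field K] {p : ℕ} [Fact p.Prime] (κ : ZpExtension K p) {m : ℕ} (hm : 1 ≤ m) (k : ℕ)
  {M : Type u} [AddCommGroup M] [DistribMulAction (absoluteGaloisGroup K) M] [TopologicalSpace M] [DiscreteTopology M]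
  (χ : absoluteGaloisGroup K →* EisensteinCoeff p m k) (ρ : DiscreteGaloisModule K M)
  (hact : ∀ (σ : absoluteGaloisGroup K) (x : Twisted p m k M),
    κ.eisensteinTwist ρ hm k σ x = (ofTwisted χ M).symm (σ • ofTwisted χ M x))
  (κ₀ : ZpExtension K p) (hM : ∀ a : M, p ^ k • a = 0) (hχker : ∀ σ ∈ κ₀.kerSubgroup, χ σ = 1)

/-! ### Class-level properties of the level readout: image `⊆ ker ψ_m`, injectivity -/

section LevelReadoutProofs

omit [DistribMulAction (absoluteGaloisGroup K) M] [TopologicalSpace M] [DiscreteTopology M] in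
/-- `λ(y) = λ([π_{m-1}^*] y)`: the tail readout only sees the last dual coordinate. [cite: Washington1997, §13.2] -/
theorem tailReadout_eq_tailReadout_dualFamily_last_smul (y : Twisted p m k M) :
    Twisted.tailReadout p hm k hM y =
      Twisted.tailReadout p hm k hM (EisensteinCoeff.dualFamily p hm k
        ⟨m - 1, Nat.sub_lt (lt_of_lt_of_le zero_lt_one hm) zero_lt_one⟩ • y) := by
  conv_lhs => rw [Twisted.eq_sum_tmul_tailReadout p hm k hM y, Twisted.tailReadout_sum p hm k hM]

include hact hχker in
/-- **The coordinate cocycles of a class of `H¹(K, M ⊗ A_{m,k}(χ))` restricted to `K_∞`**: for a 1-cocycle `ξ` of D1's module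
there are 1-cocycles `φ_j` (`j < m`) of `Gal(K̄/K_∞)` in `M` with `φ_j(h) = λ_k([π_j^*] ξ(h))` (continuity from that of `ξ`; the cocycle
identity from `χ = 1` on `ker κ₀` and `λ_k ∘ (1 ⊗ h) = h ∘ λ_k`). [cite: Howard2004HeegnerKolyvagin, §2.2] [cite: GreenbergLNM1716, §4 p. 107] -/
theorem exists_coordCocycles (ξ : contOneCocycles (κ.eisensteinTwist ρ hm k).toTopRep) :
    ∃ φ : Fin m → contOneCocycles (discreteTopRep κ₀.kerSubgroup M),
      ∀ (j : Fin m) (h : κ₀.kerSubgroup), (φ j).1 h =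
        Twisted.tailReadout p hm k hM (EisensteinCoeff.dualFamily p hm k j • ξ.1 (h : absoluteGaloisGroup K)) := by
  have hcont : ∀ j : Fin m, Continuous fun h : κ₀.kerSubgroup ↦
      Twisted.tailReadout p hm k hM (EisensteinCoeff.dualFamily p hm k j • ξ.1 (h : absoluteGaloisGroup K)) := fun j ↦
    (continuous_of_discreteTopology (f := fun x : Twisted p m k M ↦
      Twisted.tailReadout p hm k hM (EisensteinCoeff.dualFamily p hm k j • x))).comp
      (ξ.1.continuous.comp continuous_subtype_val)
  have hcoc : ∀ (j : Fin m) (g h : κ₀.kerSubgroup),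
      Twisted.tailReadout p hm k hM (EisensteinCoeff.dualFamily p hm k j • ξ.1 ((g * h : κ₀.kerSubgroup) : absoluteGaloisGroup K)) =
        Twisted.tailReadout p hm k hM (EisensteinCoeff.dualFamily p hm k j • ξ.1 (g : absoluteGaloisGroup K)) +
          (discreteTopRep κ₀.kerSubgroup M).ρ g
            (Twisted.tailReadout p hm k hM (EisensteinCoeff.dualFamily p hm k j • ξ.1 (h : absoluteGaloisGroup K))) := by
    intro j g h
    change _ = _ + (g : absoluteGaloisGroup K) •
      Twisted.tailReadout p hm k hM (EisensteinCoeff.dualFamily p hm k j • ξ.1 (h : absoluteGaloisGroup K))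
    rw [Subgroup.coe_mul, κ.eisensteinTwist_contOneCocycles_apply_mul hm k χ ρ hact ξ, hχker _ g.2, one_smul, smul_add,
      map_add, IwasawaDual.tailReadout_dualFamily_smul_mapEnd hm k hM]
  exact ⟨fun j ↦ ⟨⟨_, hcont j⟩, hcoc j⟩, fun _ _ ↦ rfl⟩

/-- **The level readout of `[ξ]` is the class of the last coordinate cocycle `φ_{m-1}`.**
[cite: Howard2004HeegnerKolyvagin, §2.2] [cite: GreenbergLNM1716, §4 p. 124] -/
theorem eisensteinTwistLevelReadout_oneCocycleClass (ξ : contOneCocycles (κ.eisensteinTwist ρ hm k).toTopRep)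
    (φ : Fin m → contOneCocycles (discreteTopRep κ₀.kerSubgroup M))
    (hφ : ∀ (j : Fin m) (h : κ₀.kerSubgroup), (φ j).1 h =
      Twisted.tailReadout p hm k hM (EisensteinCoeff.dualFamily p hm k j • ξ.1 (h : absoluteGaloisGroup K))) :
    κ.eisensteinTwistLevelReadout hm k χ ρ hact κ₀ hM hχker (oneCocycleClass _ ξ) =
      oneCocycleClass _ (φ ⟨m - 1, Nat.sub_lt (lt_of_lt_of_le zero_lt_one hm) zero_lt_one⟩) := by
  rw [eisensteinTwistLevelReadout_apply, eisensteinTwistCohomologyEquiv_oneCocycleClass]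
  have h1 : ResKernel.resSubgroup κ₀.kerSubgroup (TwistedBy χ M) (oneCocycleClass _ (contOneCocycles.pullback
        ((ContinuousMulEquiv.refl (absoluteGaloisGroup K)).symm : absoluteGaloisGroup K →ₜ* absoluteGaloisGroup K)
        (κ.eisensteinTwistToTwistedByHom hm k χ ρ hact) ξ)) =
      oneCocycleClass _ (contOneCocycles.pullback (subgroupIncl κ₀.kerSubgroup)
        (resHomOfEquivariant (subgroupIncl κ₀.kerSubgroup) (AddMonoidHom.id (TwistedBy χ M)) (fun _ _ ↦ rfl))
        (contOneCocycles.pullback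
          ((ContinuousMulEquiv.refl (absoluteGaloisGroup K)).symm : absoluteGaloisGroup K →ₜ* absoluteGaloisGroup K)
          (κ.eisensteinTwistToTwistedByHom hm k χ ρ hact) ξ)) :=
    map_oneCocycleClass _ _ _ _
  rw [h1]
  have h2 := map_oneCocycleClass _ (ContinuousMonoidHom.id κ₀.kerSubgroup)
    (resHomOfEquivariant (ContinuousMonoidHom.id κ₀.kerSubgroup)
      ((Twisted.tailReadout p hm k hM).comp (ofTwisted χ M).symm.toAddMonoidHom) (readout_id_smul κ₀ hm k hM hχker))
    (contOneCocycles.pullback (subgroupIncl κ₀.kerSubgroup)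
        (resHomOfEquivariant (subgroupIncl κ₀.kerSubgroup) (AddMonoidHom.id (TwistedBy χ M)) (fun _ _ ↦ rfl))
        (contOneCocycles.pullback
          ((ContinuousMulEquiv.refl (absoluteGaloisGroup K)).symm : absoluteGaloisGroup K →ₜ* absoluteGaloisGroup K)
          (κ.eisensteinTwistToTwistedByHom hm k χ ρ hact) ξ))
  erw [h2]
  congr 1
  apply Subtype.ext
  ext h
  rw [contOneCocycles.pullback_apply, contOneCocycles.pullback_apply, contOneCocycles.pullback_apply, hφ]
  change Twisted.tailReadout p hm k hM ((ofTwisted χ M).symm (ofTwisted χ M (ξ.1 (h : absoluteGaloisGroup K)))) = _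
  rw [AddEquiv.symm_apply_apply, tailReadout_eq_tailReadout_dualFamily_last_smul hm k hM]

/-- **The image of the level readout is killed by `ψ_m = (conj_γ − 1)^m + p`**: for every class `c ∈ H¹(K, M ⊗ A_{m,k}(χ))`,
`((θ − 1)^m + p) (readout (res c)) = 0` in `H¹(K_∞, M)` (`θ = conj_γ`, `γ` with `χ γ · (1+T) = 1`) — Howard's
«`H¹(K, A_𝔮) → H¹(K_∞, A)[𝔮]`», Greenberg's «`H¹(F_∞, A_s) = H¹(F_∞, E[p^∞]) ⊗ κ^s`», at finite level.
[cite: Howard2004HeegnerKolyvagin, §2.2, proof of Thm. 2.2.10 (𝔮 = T^m + p)] [cite: GreenbergLNM1716, §4 pp. 107, 124] -/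
theorem psi_apply_eisensteinTwistLevelReadout_eq_zero {γ : absoluteGaloisGroup K}
    (hχγ : χ γ * EisensteinCoeff.onePlusT p m k = 1)
    (θ : AddMonoid.End (subgroupH1 κ₀.kerSubgroup M)) (hθ : ∀ c, θ c = conjH1 κ₀.kerSubgroup M γ c)
    (c : galoisCohomology (κ.eisensteinTwist ρ hm k) 1) :
    ((θ - 1) ^ m + (p : AddMonoid.End (subgroupH1 κ₀.kerSubgroup M)))
      (κ.eisensteinTwistLevelReadout hm k χ ρ hact κ₀ hM hχker c) = 0 := by
  obtain ⟨ξ, rfl⟩ := oneCocycleClass_surjective _ c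
  obtain ⟨φ, hφ⟩ := κ.exists_coordCocycles hm k χ ρ hact κ₀ hM hχker ξ
  rw [κ.eisensteinTwistLevelReadout_oneCocycleClass hm k χ ρ hact κ₀ hM hχker ξ φ hφ]
  exact IwasawaDual.psi_apply_oneCocycleClass_last_eq_zero κ₀ hm k hM χ (map_mul χ) hχker hχγ (fun σ ↦ ξ.1 σ)
    (κ.eisensteinTwist_contOneCocycles_apply_mul hm k χ ρ hact ξ) φ hφ θ hθ

/-- **Injectivity of the level readout** (when `M^{Gal(K̄/K_∞)} = 0`): a class of `H¹(K, M ⊗ A_{m,k}(χ))` whose readout in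
`H¹(K_∞, M)` vanishes is zero — all coordinate classes vanish by the shift relations `[φ_{j-1}] = (conj_γ − 1)[φ_j]`
(`coord_eq_pow_sub_one_apply_last`), and then the cocycle is a twisted coboundary
(`exists_eq_twistedCoboundary_of_forall_oneCocycleClass_eq_zero`). With `psi_apply_…_eq_zero` and
`exists_eisensteinTwistLevelReadout_eq`: **`H¹(K, M ⊗ A_{m,k}(χ)) ≅ H¹(K_∞, M)[(conj_γ − 1)^m + p]`**.
[cite: Howard2004HeegnerKolyvagin, §2.2, Lemma 1.3.3, proof of Thm. 2.2.10] [cite: GreenbergLNM1716, §4 pp. 107, 124] -/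
theorem eq_zero_of_eisensteinTwistLevelReadout_eq_zero {γ : absoluteGaloisGroup K}
    (hχγ : χ γ * EisensteinCoeff.onePlusT p m k = 1)
    (hfix : ∀ a : M, (∀ σ ∈ κ₀.kerSubgroup, σ • a = a) → a = 0)
    (c : galoisCohomology (κ.eisensteinTwist ρ hm k) 1)
    (hc : κ.eisensteinTwistLevelReadout hm k χ ρ hact κ₀ hM hχker c = 0) : c = 0 := by
  obtain ⟨ξ, rfl⟩ := oneCocycleClass_surjective _ c
  obtain ⟨φ, hφ⟩ := κ.exists_coordCocycles hm k χ ρ hact κ₀ hM hχker ξ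
  have hlast : m - 1 < m := Nat.sub_lt (lt_of_lt_of_le zero_lt_one hm) zero_lt_one
  have hf := κ.eisensteinTwist_contOneCocycles_apply_mul hm k χ ρ hact ξ
  -- the shift relations `conj_γ [φ_j] = [φ_j] + [φ_{j-1}]`, `conj_γ [φ_0] = [φ_0] - p [φ_{m-1}]`
  have hrec := fun j ↦ IwasawaDual.conjH1_oneCocycleClass_coord_eq κ₀ hm k hM χ (map_mul χ) hχker hχγ (fun σ ↦ ξ.1 σ)
    hf φ hφ j
  -- the last coordinate class is the readout, hence zero; so are all the others
  have hzero : oneCocycleClass _ (φ ⟨m - 1, hlast⟩) = 0 := by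
    rw [← κ.eisensteinTwistLevelReadout_oneCocycleClass hm k χ ρ hact κ₀ hM hχker ξ φ hφ]; exact hc
  have hall : ∀ j : Fin m, oneCocycleClass _ (φ j) = 0 := by
    intro j
    have hd : m - 1 - (j : ℕ) < m := lt_of_le_of_lt (Nat.sub_le _ _) hlast
    have key := IwasawaDual.coord_eq_pow_sub_one_apply_last (p := p) hm
      (conjH1 κ₀.kerSubgroup M γ : AddMonoid.End (subgroupH1 κ₀.kerSubgroup M)) (fun j ↦ oneCocycleClass _ (φ j)) hrec hd
    have hidx : (⟨m - 1 - (m - 1 - (j : ℕ)), lt_of_le_of_lt (Nat.sub_le _ _) hlast⟩ : Fin m) = j :=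
      Fin.ext (by have := j.2; show m - 1 - (m - 1 - (j : ℕ)) = (j : ℕ); omega)
    rw [hidx] at key
    rw [key, hzero, map_zero]
  -- no `Gal(K̄/K_∞)`-fixed vectors in `A_{m,k} ⊗ M`
  have hfix' : ∀ x : Twisted p m k M,
      (∀ h ∈ κ₀.kerSubgroup, CoeffExtension.mapEnd (DistribMulAction.toAddMonoidEnd _ M h) x = x) → x = 0 := by
    intro x hx
    have hw := eq_zero_of_forall_smul_eq (χ := χ) hm hM κ₀.kerSubgroup hχker hfix (ofTwisted χ M x) fun σ hσ ↦ by
      apply (ofTwisted χ M).symm.injective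
      rw [ofTwisted_symm_smul_of_eq_one (hχker σ hσ), AddEquiv.symm_apply_apply, hx σ hσ]
    simpa using congrArg (ofTwisted χ M).symm hw
  obtain ⟨x, hx⟩ := IwasawaDual.exists_eq_twistedCoboundary_of_forall_oneCocycleClass_eq_zero κ₀ hm k hM χ (map_mul χ)
    hχker hfix' (fun σ ↦ ξ.1 σ) hf φ hφ hall
  refine (oneCocycleClass_eq_zero_iff _ ξ).mpr ⟨x, fun σ ↦ ?_⟩
  rw [hx σ]
  change _ = κ.eisensteinTwist ρ hm k σ x - x
  rw [hact, ofTwisted_symm_smul, AddEquiv.symm_apply_apply]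

end LevelReadoutProofs

end ZpExtension

end Literature.NumberTheory.EllipticCurves
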